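import Literature.NumberTheory.EllipticCurves.MultiplicativeReductionInertiaShapeProofs
import Literature.NumberTheory.GaloisRepresentations.ModPCyclotomicCharacterInertiaSurjective
import Literature.NumberTheory.EllipticCurves.GreenbergSelmer
import HarnessLib

/-!
# The Tate line at a multiplicative `v ∣ p` is stable under the DECOMPOSITION group
# (Serre 1972, §1.12; Silverman, *Advanced Topics* V.5.3–V.5.4, V.6.1)

`Proofs` file (theorems only: no definition, no named fact), topic `NumberTheory/EllipticCurves`;
the decomposition-group upgrade of `MultiplicativeReductionInertiaShapeProofs`
(`WeierstrassCurve.exists_line_le_geomTorsion_of_hasMultiplicativeReductionAt`: at a multiplicative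
`v ∣ p`, `p` odd, there is `Λ ≤ E[p]` with `#Λ ≤ p` receiving `τ P - P` for every `τ` in the
INERTIA group `I_{K_v}` and every `P ∈ E[p]`).

MATHEMATICS.  By Tate's uniformisation (Serre, Invent. Math. 15 (1972) §1.12: over the unramified
extension `K'/K_v` of degree `≤ 2` on which `E ≅ E_q` one has the exact sequence
`0 → μ_p → E_p → ℤ/pℤ → 0` of Galois modules, whence Prop. 13 and its Corollary; Silverman,
*Advanced Topics* V.5.3 (Tate), V.5.2 (c) / V.5.4: `ψ : E_q(K̄) ≅ E(K̄)` with
`ψ(P^σ) = χ(σ) ψ(P)^σ` for the quadratic character `χ` of `K'/K`, and V.3.1 (d): the uniformisation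
commutes with `G_{K̄/K}`) the line `ψ φ(μ_p) ≤ E[p]` is stable under the whole local Galois group
`G_{K_v}`, not only under inertia.  The tree has no Tate uniformisation; the proof given here is
ELEMENTARY from the inertia statement already in the tree, by a uniqueness argument:

* (`AddSubgroup.eq_of_forall_smul_sub_mem_of_card_eq_prime`) in an abelian group with a group
  action, two subgroups `Λ₁, Λ₂` of prime order `p` both receiving `τ P - P` for all `τ ∈ I`,
  `P ∈ T` COINCIDE as soon as some `τ ∈ I` moves some `P ∈ T` (otherwise `Λ₁ ⊓ Λ₂ = 0` receives a
  non-zero `τ P - P`);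
* (`AddSubgroup.smul_mem_of_forall_smul_sub_mem_of_card_eq_prime`) hence such a `Λ` is stable under
  every `σ` normalising `I` and `T`: `σ Λ` has the same property
  (`τ P - P = σ ((σ⁻¹ τ σ)(σ⁻¹ P) - σ⁻¹ P)`), so `σ Λ = Λ`;
* at a multiplicative `v ∣ p` with `p` odd the inertia group DOES move `E[p]` as soon as the mod `p`
  cyclotomic character is non-trivial on `I_{K_v}` (`det ρ̄_{E,p} = χ̄_p`,
  `WeierstrassCurve.det_eq_modPCyclotomicCharacter_of_isTorsionGaloisRep_holds`), which is the case
  when `e(v ∣ p) = f(v ∣ p) = 1` (`exists_mem_absInertia_modPCyclotomicCharacterZMod_eq`: `χ̄_p` maps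
  `I_{K_v}` ONTO `𝔽_pˣ`; Serre 1972 §1.8) and in particular for `K = ℚ`
  (`Rat.exists_mem_absInertia_adicCompletion_modPCyclotomicCharacterZMod_eq`); then `#Λ = p`
  exactly (Serre 1972, §1.12 Cor. (c)) and `I_{K_v}` is normal in `Γ_{K_v}`
  (`absInertia_normal_holds`), so `Λ` is stable under `Γ_{K_v}`.

Results (`K` a number field, `E/K` elliptic, `p` odd, `v ∣ p` multiplicative):
* `WeierstrassCurve.exists_decompStableLine_geomTorsion_of_hasMultiplicativeReductionAt_of_exists_ne_one`
  — given `τ ∈ I_{K_v}` with `χ̄_p(τ) ≠ 1`: a line `Λ ≤ E[p]`, `#Λ = p`, stable under `Γ_{K_v}`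
  (through `absGaloisRestrict K K_v`), with `I_{K_v}` trivial on `E[p]/Λ` — the output shape of
  the good-ordinary companion `exists_line_geomTorsion_of_not_dvd_frobeniusTraceAt`;
* `WeierstrassCurve.exists_decompStableLine_geomTorsion_of_hasMultiplicativeReductionAt` — the same
  under `e = f = 1` (`p` a uniformiser of `K_v`, residue field `𝔽_p`);
* `WeierstrassCurve.exists_decompStableLine_geomTorsion_of_hasMultiplicativeReductionAt_rat` — `K = ℚ`,
  no extra hypothesis; and `…_rat_decomp`, the same in the currency
  `GreenbergSelmer.decomp v` / `GreenbergSelmer.inertia v` of the Greenberg–Selmer files.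

Written for cell `bsd-wall` (run/shared/lean/pub/bsd-wall/), lane (2): with
`Summits/BirchSwinnertonDyer/Rank1Residual/WAll/TargetAdditiveAtThreeWildLocalTypeDecompLine.lean`
it gives «a class with NO `D_3`-stable line in `E[3]` has no MULTIPLICATIVE twin» (census bucket C).
No new definition, no named fact (D-0026).

## References

* [SerreInventiones1972] J.-P. Serre, *Propriétés galoisiennes des points d'ordre fini des courbes
  elliptiques*, Invent. Math. 15 (1972), §1.12 (exact sequence `0 → μ_p → E_p → ℤ/p → 0` over `K'`,
  Prop. 13 and Cor.), §1.8 (Prop. 8 and Cor.: `θ_{p-1} = χ` when `e = 1`); read in *Oeuvres* III.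
* [SilvermanATAEC1994] J. H. Silverman, *Advanced Topics in the Arithmetic of Elliptic Curves*,
  GTM 151, Ch. V: Thm. 3.1 (d), Lemma 5.2 (c), Thm. 5.3, Cor. 5.4, Prop. 6.1.
* [SerreLocalFields1979] J.-P. Serre, *Local Fields*, Ch. IV §4, Prop. 17–18 (`χ̄_p(I_{ℚ_p}) = 𝔽_pˣ`).
-/

noncomputable section

open scoped Classical NumberField
open NumberField IsDedekindDomain Field

/-! ## §A. Uniqueness of a line of prime order receiving `τ P - P`, and its stability -/

namespace Literature.NumberTheory.EllipticCurves

section Uniqueness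

variable {G : Type*} {A : Type*} [Group G] [AddCommGroup A] [DistribMulAction G A]

/-- **Uniqueness of the line.**  Let a group `G` act on an abelian group `A`, `I ⊆ G`, `T ≤ A`.
Two subgroups `Λ₁, Λ₂ ≤ A` of the same prime order `p` which both contain `τ • P - P` for all
`τ ∈ I`, `P ∈ T` are EQUAL, provided some `τ ∈ I` moves some `P ∈ T` (if `Λ₁ ≠ Λ₂` then
`Λ₁ ⊓ Λ₂ = ⊥` would contain the non-zero `τ • P - P`).  This is the group theory behind Serre's
"`ρ̄|I ⊆ (χ *; 0 1)` with `χ ≠ 1` on `I`" (Invent. Math. 1972, §1.11 Cor. (c), §1.12 Cor. (c)).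
[cite: SerreInventiones1972, §1.12, Prop. 13 and Cor.] -/
theorem AddSubgroup.eq_of_forall_smul_sub_mem_of_card_eq_prime {p : ℕ} (hp : p.Prime)
    {I : Set G} {T : AddSubgroup A} {Λ₁ Λ₂ : AddSubgroup A} (h₁ : Nat.card Λ₁ = p)
    (h₂ : Nat.card Λ₂ = p) (hq₁ : ∀ τ ∈ I, ∀ P ∈ T, τ • P - P ∈ Λ₁)
    (hq₂ : ∀ τ ∈ I, ∀ P ∈ T, τ • P - P ∈ Λ₂) (hmove : ∃ τ ∈ I, ∃ P ∈ T, τ • P ≠ P) :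
    Λ₁ = Λ₂ := by
  haveI : Finite Λ₁ := Nat.finite_of_card_ne_zero (by rw [h₁]; exact hp.ne_zero)
  haveI : Finite Λ₂ := Nat.finite_of_card_ne_zero (by rw [h₂]; exact hp.ne_zero)
  by_contra hne
  -- `#(Λ₁ ⊓ Λ₂) ∣ p`
  have hdvd : Nat.card ↥(Λ₁ ⊓ Λ₂) ∣ p := h₁ ▸ AddSubgroup.card_dvd_of_le inf_le_left
  rcases (Nat.dvd_prime hp).mp hdvd with h1 | hp'
  · -- trivial intersection: but it contains a non-zero `τ • P - P`
    obtain ⟨τ, hτ, P, hP, hmv⟩ := hmove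
    have hmem : τ • P - P ∈ Λ₁ ⊓ Λ₂ := AddSubgroup.mem_inf.mpr ⟨hq₁ τ hτ P hP, hq₂ τ hτ P hP⟩
    rw [AddSubgroup.eq_bot_of_card_eq _ h1, AddSubgroup.mem_bot, sub_eq_zero] at hmem
    exact hmv hmem
  · -- full intersection: `Λ₁ = Λ₁ ⊓ Λ₂ = Λ₂`
    have e₁ : Λ₁ ⊓ Λ₂ = Λ₁ := AddSubgroup.eq_of_le_of_card_ge inf_le_left (by rw [h₁, hp'])
    have e₂ : Λ₁ ⊓ Λ₂ = Λ₂ := AddSubgroup.eq_of_le_of_card_ge inf_le_right (by rw [h₂, hp'])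
    exact hne (e₁.symm.trans e₂)

/-- **Stability under the normaliser.**  With `G`, `A`, `I`, `T` as above, let `Λ ≤ A` have prime
order `p` and contain `τ • P - P` for all `τ ∈ I`, `P ∈ T`, and let some `τ ∈ I` move some
`P ∈ T`.  Then `Λ` is stable under every `σ ∈ G` with `σ⁻¹ I σ ⊆ I` and `σ⁻¹ T ⊆ T`: the subgroup
`σ • Λ` again has order `p` and contains every `τ • P - P = σ • ((σ⁻¹τσ) • σ⁻¹P - σ⁻¹P)`, so
`σ • Λ = Λ` by `AddSubgroup.eq_of_forall_smul_sub_mem_of_card_eq_prime`.  (Applied below with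
`I` = inertia, `σ` in the decomposition group, `T = E[p]`.)
[cite: SerreInventiones1972, §1.12, Prop. 13 and Cor.] -/
theorem AddSubgroup.smul_mem_of_forall_smul_sub_mem_of_card_eq_prime {p : ℕ} (hp : p.Prime)
    {I : Set G} {T : AddSubgroup A} {Λ : AddSubgroup A} (hΛ : Nat.card Λ = p)
    (hq : ∀ τ ∈ I, ∀ P ∈ T, τ • P - P ∈ Λ) (hmove : ∃ τ ∈ I, ∃ P ∈ T, τ • P ≠ P)
    {σ : G} (hσI : ∀ τ ∈ I, σ⁻¹ * τ * σ ∈ I) (hσT : ∀ P ∈ T, σ⁻¹ • P ∈ T) :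
    ∀ x ∈ Λ, σ • x ∈ Λ := by
  -- the translate `σ • Λ`
  set f : A →+ A := DistribSMul.toAddMonoidHom A σ with hf
  have hfinj : Function.Injective f := fun x y hxy ↦ MulAction.injective σ hxy
  have hcard' : Nat.card ↥(Λ.map f) = p := by rw [AddSubgroup.card_map_of_injective hfinj, hΛ]
  have hq' : ∀ τ ∈ I, ∀ P ∈ T, τ • P - P ∈ Λ.map f := by
    intro τ hτ P hP
    refine AddSubgroup.mem_map.mpr
      ⟨(σ⁻¹ * τ * σ) • (σ⁻¹ • P) - σ⁻¹ • P, hq _ (hσI τ hτ) _ (hσT P hP), ?_⟩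
    have hconj : σ * (σ⁻¹ * τ * σ) * σ⁻¹ = τ := by group
    rw [hf, DistribSMul.toAddMonoidHom_apply, smul_sub, smul_inv_smul, smul_smul, smul_smul,
      hconj]
  have heq : Λ = Λ.map f :=
    AddSubgroup.eq_of_forall_smul_sub_mem_of_card_eq_prime hp hΛ hcard' hq hq' hmove
  intro x hx
  have hx' : f x ∈ Λ.map f := AddSubgroup.mem_map.mpr ⟨x, hx, rfl⟩
  rw [← heq] at hx'
  exact hx'

/-- `-1 ≠ 1` in `(ℤ/pℤ)ˣ` for a prime `p ≠ 2`. [folklore] [cite: SerreInventiones1972, §1.8] -/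
theorem units_zmod_neg_one_ne_one {p : ℕ} [hp : Fact p.Prime] (hp2 : p ≠ 2) :
    (-1 : (ZMod p)ˣ) ≠ 1 := by
  haveI : Fact (2 < p) := ⟨lt_of_le_of_ne hp.out.two_le (Ne.symm hp2)⟩
  intro h
  have h2 : ((-1 : (ZMod p)ˣ) : ZMod p) = ((1 : (ZMod p)ˣ) : ZMod p) := by rw [h]
  rw [Units.val_neg, Units.val_one] at h2
  exact ZMod.neg_one_ne_one h2

end Uniqueness

end Literature.NumberTheory.EllipticCurves

/-! ## §B. The Tate line at a multiplicative `v ∣ p` is `Γ_{K_v}`-stable -/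

namespace WeierstrassCurve

open Literature.NumberTheory.EllipticCurves Literature.NumberTheory.GaloisRepresentations Field
  IsDedekindDomain.HeightOneSpectrum ValuativeRel Rat.HeightOneSpectrum
  Literature.NumberTheory.GaloisRepresentations.IsNonarchimedeanLocalField

variable {K : Type} [Field K] [NumberField K] (W : WeierstrassCurve K)

/-- **Serre 1972 §1.12 / Tate: at a multiplicative `v ∣ p` (`p` odd) with `χ̄_p` non-trivial on
`I_{K_v}`, `E[p]` has a line stable under the DECOMPOSITION group, with inertia trivial on the
quotient.**  For an elliptic curve `E` over a number field `K`, an odd prime `p`, a finite place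
`v ∣ p` of multiplicative reduction and an element `τ₀` of the inertia group of `K_v` with
`χ̄_p(τ₀) ≠ 1`, there is a subgroup `Λ ≤ E[p]` of order `p`, stable under `Γ_{K_v}` (acting through
`absGaloisRestrict K K_v`), such that `τ P - P ∈ Λ` for every `τ ∈ I_{K_v}` and `P ∈ E[p]`.
`Λ` is the line of `exists_line_le_geomTorsion_of_hasMultiplicativeReductionAt`; it has exactly `p`
elements because `det ρ̄_{E,p}(τ₀) = χ̄_p(τ₀) ≠ 1` forces `τ₀` to move `E[p]` (Serre 1972 §1.12
Cor. (c)), and it is `Γ_{K_v}`-stable by uniqueness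
(`AddSubgroup.smul_mem_of_forall_smul_sub_mem_of_card_eq_prime`; `I_{K_v} ⊴ Γ_{K_v}`,
`absInertia_normal_holds`).  In Tate's model `Λ = ψφ(μ_p)`.
[cite: SerreInventiones1972, §1.12, Prop. 13 and Cor.]
[cite: SilvermanATAEC1994, V §5 Thm. 5.3, Lemma 5.2 (c), Cor. 5.4; V §6 Prop. 6.1] -/
theorem exists_decompStableLine_geomTorsion_of_hasMultiplicativeReductionAt_of_exists_ne_one
    [W.IsElliptic] {p : ℕ} [hp : Fact p.Prime] (hp2 : p ≠ 2) {v : HeightOneSpectrum (𝓞 K)}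
    (hpv : (p : 𝓞 K) ∈ v.asIdeal) (hmult : W.HasMultiplicativeReductionAt v)
    [NeZero ((p : ℕ) : v.adicCompletion K)]
    (hχ : ∃ τ ∈ absInertia (v.adicCompletion K),
      modPCyclotomicCharacterZMod (v.adicCompletion K) p τ ≠ 1) :
    ∃ Λ : AddSubgroup (geomPoints W), Λ ≤ geomTorsion W p ∧ Nat.card Λ = p ∧
      (∀ (σ : absoluteGaloisGroup (v.adicCompletion K)), ∀ x ∈ Λ,
        absGaloisRestrict K (v.adicCompletion K) σ • x ∈ Λ) ∧
      (∀ τ ∈ absInertia (v.adicCompletion K), ∀ P ∈ geomTorsion W p,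
        absGaloisRestrict K (v.adicCompletion K) τ • P - P ∈ Λ) := by
  haveI : NeZero ((p : ℕ) : K) := ⟨Nat.cast_ne_zero.mpr hp.out.ne_zero⟩
  have hp0 : p ≠ 0 := hp.out.ne_zero
  set res := absGaloisRestrict K (v.adicCompletion K) with hres
  obtain ⟨Λ, hΛ, hcard_le, hquot⟩ :=
    W.exists_line_le_geomTorsion_of_hasMultiplicativeReductionAt hp2 hpv hmult
  /- (1) some inertia element moves `E[p]`: `det ρ̄(res τ₀) = χ̄_p(τ₀) ≠ 1` -/
  obtain ⟨τ₀, hτ₀, hχτ₀⟩ := hχ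
  obtain ⟨ρ, hρ⟩ := W.exists_isTorsionGaloisRep p
  have hdet : Matrix.GeneralLinearGroup.det (ρ (res τ₀)) =
      modPCyclotomicCharacterZMod (v.adicCompletion K) p τ₀ := by
    rw [hres, det_eq_modPCyclotomicCharacter_of_isTorsionGaloisRep_holds W p ρ hρ,
      modPCyclotomicCharacterZMod_absGaloisRestrict]
  have hρne : ρ (res τ₀) ≠ 1 := fun h ↦ hχτ₀ (by rw [← hdet, h, map_one])
  have hmoved : ∃ x ∈ geomTorsion W p, res τ₀ • x ≠ x := by
    by_contra hall
    push Not at hall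
    obtain ⟨e, he⟩ := id hρ
    apply hρne
    refine Units.ext (Matrix.ext fun i c ↦ ?_)
    have hfix : res τ₀ • e.symm (Pi.single c 1) = e.symm (Pi.single c 1) := Subtype.ext (by
      rw [Literature.NumberTheory.EllipticCurves.AddSubgroup.torsionBy.coe_smul]
      exact hall _ (e.symm (Pi.single c 1)).2)
    have h1 := he (res τ₀) (e.symm (Pi.single c 1))
    rw [hfix, AddEquiv.apply_symm_apply] at h1
    have h2 := congrFun h1 i
    rw [Matrix.mulVec_single_one, Pi.single_apply] at h2
    rw [Units.val_one, Matrix.one_apply]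
    exact h2.symm
  have hmove : ∃ τ ∈ (res '' (absInertia (v.adicCompletion K) : Set _)),
      ∃ P ∈ geomTorsion W p, τ • P ≠ P := by
    obtain ⟨x, hx, hne⟩ := hmoved
    exact ⟨res τ₀, ⟨τ₀, hτ₀, rfl⟩, x, hx, hne⟩
  /- (2) `#Λ = p` -/
  have hcard : Nat.card Λ = p := by
    obtain ⟨x, hx, hne⟩ := hmoved
    have hmem : res τ₀ • x - x ∈ Λ := hquot τ₀ hτ₀ x hx
    have hne0 : res τ₀ • x - x ≠ 0 := sub_ne_zero.mpr hne
    have hA : Nat.card (geomTorsion W p) = p ^ 2 :=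
      card_torsionBy_eq_sq (E := W.baseChange (AlgebraicClosure K)) (n := p) (by exact_mod_cast hp0)
    haveI : Finite (geomTorsion W p) := Nat.finite_of_card_ne_zero (by rw [hA]; positivity)
    have hdvd : Nat.card Λ ∣ p ^ 2 := hA ▸ AddSubgroup.card_dvd_of_le hΛ
    obtain ⟨i, hi, hci⟩ := (Nat.dvd_prime_pow hp.out).mp hdvd
    interval_cases i
    · exfalso
      rw [pow_zero] at hci
      have hbot : Λ = ⊥ := AddSubgroup.eq_bot_of_card_eq Λ hci
      rw [hbot, AddSubgroup.mem_bot] at hmem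
      exact hne0 hmem
    · rw [hci, pow_one]
    · exfalso
      rw [hci] at hcard_le
      have : p ^ 2 ≤ p ^ 1 := by rwa [pow_one]
      exact absurd (Nat.pow_le_pow_iff_right hp.out.one_lt |>.mp this) (by norm_num)
  /- (3) the quotient property on the IMAGE of inertia, and stability under `res σ` -/
  have hq : ∀ τ ∈ (res '' (absInertia (v.adicCompletion K) : Set _)),
      ∀ P ∈ geomTorsion W p, τ • P - P ∈ Λ := by
    rintro _ ⟨τ, hτ, rfl⟩ P hP
    exact hquot τ hτ P hP
  haveI hIn : (absInertia (v.adicCompletion K)).Normal := absInertia_normal_holds (v.adicCompletion K)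
  refine ⟨Λ, hΛ, hcard, fun σ x hx ↦ ?_, hquot⟩
  refine AddSubgroup.smul_mem_of_forall_smul_sub_mem_of_card_eq_prime hp.out hcard hq hmove
    (σ := res σ) ?_ ?_ x hx
  · -- `(res σ)⁻¹ (res τ) (res σ) = res (σ⁻¹ τ σ)` with `σ⁻¹ τ σ ∈ I_{K_v}`
    rintro _ ⟨τ, hτ, rfl⟩
    refine ⟨σ⁻¹ * τ * σ, hIn.conj_mem' τ hτ σ, ?_⟩
    rw [map_mul, map_mul, map_inv]
  · -- `E[p]` is stable under `Γ_K`
    intro P hP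
    exact smul_mem_torsionBy _ hP

/-- **The same under `e(v ∣ p) = f(v ∣ p) = 1`** (`p` a uniformiser of `K_v`, residue field `𝔽_p`;
e.g. `K = ℚ`): then `χ̄_p` maps `I_{K_v}` onto `𝔽_pˣ`
(`exists_mem_absInertia_modPCyclotomicCharacterZMod_eq`, Serre 1972 §1.8), so some inertia element
has `χ̄_p = -1 ≠ 1` (`p` odd), and
`exists_decompStableLine_geomTorsion_of_hasMultiplicativeReductionAt_of_exists_ne_one` applies.
[cite: SerreInventiones1972, §1.12, Prop. 13 and Cor.; §1.8, Prop. 8 and Cor.]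
[cite: SilvermanATAEC1994, V §5 Thm. 5.3, Cor. 5.4; V §6 Prop. 6.1] -/
theorem exists_decompStableLine_geomTorsion_of_hasMultiplicativeReductionAt
    [W.IsElliptic] {p : ℕ} [hp : Fact p.Prime] (hp2 : p ≠ 2) {v : HeightOneSpectrum (𝓞 K)}
    (hpv : (p : 𝓞 K) ∈ v.asIdeal) (hmult : W.HasMultiplicativeReductionAt v)
    (hirr : Irreducible ((p : ℕ) : 𝒪[v.adicCompletion K]))
    (hq : residueFieldCard (v.adicCompletion K) = p) :
    ∃ Λ : AddSubgroup (geomPoints W), Λ ≤ geomTorsion W p ∧ Nat.card Λ = p ∧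
      (∀ (σ : absoluteGaloisGroup (v.adicCompletion K)), ∀ x ∈ Λ,
        absGaloisRestrict K (v.adicCompletion K) σ • x ∈ Λ) ∧
      (∀ τ ∈ absInertia (v.adicCompletion K), ∀ P ∈ geomTorsion W p,
        absGaloisRestrict K (v.adicCompletion K) τ • P - P ∈ Λ) := by
  haveI : NeZero ((p : ℕ) : v.adicCompletion K) := neZero_natCast_of_irreducible hirr
  refine W.exists_decompStableLine_geomTorsion_of_hasMultiplicativeReductionAt_of_exists_ne_one
    hp2 hpv hmult ?_
  obtain ⟨τ, hτ, hχ⟩ :=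
    exists_mem_absInertia_modPCyclotomicCharacterZMod_eq (F := v.adicCompletion K) hirr hq (-1)
  exact ⟨τ, hτ, by rw [hχ]; exact units_zmod_neg_one_ne_one hp2⟩

/-- **`K = ℚ`: at a multiplicative prime `p ≠ 2`, `E[p]` has a `Γ_{ℚ_p}`-stable line with inertia
trivial on the quotient** — no hypothesis beyond multiplicative reduction (`χ̄_p(I_{ℚ_p}) = 𝔽_pˣ`,
`Rat.exists_mem_absInertia_adicCompletion_modPCyclotomicCharacterZMod_eq`).  Tate / Serre 1972
§1.12: `Λ = ψφ(μ_p)`, the «toric line» of `E[p]`.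
[cite: SerreInventiones1972, §1.12, Prop. 13 and Cor.]
[cite: SilvermanATAEC1994, V §5 Thm. 5.3, Cor. 5.4; V §6 Prop. 6.1]
[cite: SerreLocalFields1979, Ch. IV §4, Prop. 17 (ii)(iii) and Prop. 18] -/
theorem exists_decompStableLine_geomTorsion_of_hasMultiplicativeReductionAt_rat
    (W : WeierstrassCurve ℚ) [W.IsElliptic] {p : ℕ} [hp : Fact p.Prime] (hp2 : p ≠ 2)
    {v : HeightOneSpectrum (𝓞 ℚ)} (hpv : ((p : ℕ) : 𝓞 ℚ) ∈ v.asIdeal)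
    (hmult : W.HasMultiplicativeReductionAt v) :
    ∃ Λ : AddSubgroup (geomPoints W), Λ ≤ geomTorsion W p ∧ Nat.card Λ = p ∧
      (∀ (σ : absoluteGaloisGroup (v.adicCompletion ℚ)), ∀ x ∈ Λ,
        absGaloisRestrict ℚ (v.adicCompletion ℚ) σ • x ∈ Λ) ∧
      (∀ τ ∈ absInertia (v.adicCompletion ℚ), ∀ P ∈ geomTorsion W p,
        absGaloisRestrict ℚ (v.adicCompletion ℚ) τ • P - P ∈ Λ) := by
  have hpe : ((primesEquiv v : Nat.Primes) : ℕ) = p := by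
    rw [(natCast_mem_asIdeal_iff_eq_primesEquiv_symm v hp.out).mp hpv, Equiv.apply_symm_apply]
  haveI : CharZero (v.adicCompletion ℚ) :=
    charZero_of_injective_algebraMap (algebraMap ℚ (v.adicCompletion ℚ)).injective
  haveI : NeZero ((p : ℕ) : v.adicCompletion ℚ) := ⟨Nat.cast_ne_zero.mpr hp.out.ne_zero⟩
  refine W.exists_decompStableLine_geomTorsion_of_hasMultiplicativeReductionAt_of_exists_ne_one
    hp2 hpv hmult ?_
  obtain ⟨τ, hτ, hχ⟩ :=
    Rat.exists_mem_absInertia_adicCompletion_modPCyclotomicCharacterZMod_eq v hpe (-1)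
  exact ⟨τ, hτ, by rw [hχ]; exact units_zmod_neg_one_ne_one hp2⟩

/-- **`K = ℚ`, in the currency of the Greenberg–Selmer files** (`GreenbergSelmer.decomp v = D_v`,
`GreenbergSelmer.inertia v = I_v`, the images of `Γ_{ℚ_v} ⊇ I_{ℚ_v}` in `Γ_ℚ`): at a multiplicative
`p ≠ 2` there is `Λ ≤ E[p]` of order `p`, stable under `D_v`, with `τ P - P ∈ Λ` for `τ ∈ I_v`,
`P ∈ E[p]`.  [cite: SerreInventiones1972, §1.12, Prop. 13 and Cor.]
[cite: SilvermanATAEC1994, V §5 Thm. 5.3, Cor. 5.4; V §6 Prop. 6.1] -/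
theorem exists_decompStableLine_geomTorsion_of_hasMultiplicativeReductionAt_rat_decomp
    (W : WeierstrassCurve ℚ) [W.IsElliptic] {p : ℕ} [hp : Fact p.Prime] (hp2 : p ≠ 2)
    {v : HeightOneSpectrum (𝓞 ℚ)} (hpv : ((p : ℕ) : 𝓞 ℚ) ∈ v.asIdeal)
    (hmult : W.HasMultiplicativeReductionAt v) :
    ∃ Λ : AddSubgroup (geomPoints W), Λ ≤ geomTorsion W p ∧ Nat.card Λ = p ∧
      (∀ σ ∈ GreenbergSelmer.decomp (K := ℚ) v, ∀ x ∈ Λ, σ • x ∈ Λ) ∧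
      (∀ τ ∈ GreenbergSelmer.inertia (K := ℚ) v, ∀ P ∈ geomTorsion W p, τ • P - P ∈ Λ) := by
  obtain ⟨Λ, hΛ, hcard, hstab, hquot⟩ :=
    W.exists_decompStableLine_geomTorsion_of_hasMultiplicativeReductionAt_rat hp2 hpv hmult
  refine ⟨Λ, hΛ, hcard, ?_, ?_⟩
  · rintro σ ⟨σ', rfl⟩ x hx
    exact hstab σ' x hx
  · rintro τ ⟨τ', hτ', rfl⟩ P hP
    exact hquot τ' hτ' P hP

end WeierstrassCurve
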